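import Literature.NumberTheory.EllipticCurves.PAdicLFunctionTameMinus
import HarnessLib

/-!
# The `ω^i`-BRANCHES of the tame transforms: `L^±_p(f, α, ω^i χ, T) = ∫ ω^i(x_p) χ(x_m) (1+T)^{ℓ(x_p)} dμ^±_{f,α,m}`
# (plus and minus measures at tame level `m`) — DEFINITIONS ONLY (every `def` has a body; nothing asserted, no named fact)

Companion of `PAdicLFunctionTame` (`padicLFunctionTame f m α χ` = the `ω⁰`-branch of the PLUS tame measure) and
`PAdicLFunctionTameMinus` (`padicLFunctionTameMinus` = the `ω⁰`-branch of the MINUS tame measure). Mazur–Tate–Teitelbaum §I.13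
decompose the `p`-adic `L`-function of `ℤ_{p,M}^× = Δ × Γ × (ℤ/M)^×` along the characters `ω^i` of the torsion `Δ`
(the BRANCHES; tree `padicLFunctionBranch`, `padicLFunctionMinusBranch` at tame level `1`); this file types the branches at tame
level `m` for both signs, literally the level-`1` branch formulas (`padicLBranchRiemannSum`, `padicLMinusBranchRiemannSum`: weight
`ζ^i` on the Teichmüller representative `ζ`) with the tame measures `msdMeasureTame` / `msdMeasureTameMinus` and a tame character
`χ` mod `m` with values in `ℚ_p`:

* `padicLRiemannSumTameBranch f m α χ i k n = ∑_ζ ζ^i ∑_{s mod pⁿ} ∑_{b mod m} χ(b) μ_{f,α,m}((ζγˢ + p^{n+e₀}ℤ_p) × {b}) (s choose k)`,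
  `padicLCoeffTameBranch`, **`padicLFunctionTameBranch f m α χ i`**;
* `padicLRiemannSumTameMinusBranch`, `padicLCoeffTameMinusBranch`, **`padicLFunctionTameMinusBranch f m α χ i`** (the same on
  `μ⁻_{f,α,m}`).

ANCHORS (kernel lemmas): at `i = 0` these are `padicLRiemannSumTame` / `padicLRiemannSumTameMinus` (`…_zero`). For ODD `i`
(at `p = 2`: `i = 1`, `ζ ∈ {±1}`) the minus branch is the tame-level-`m` object whose Birch transform is the odd branch
`L⁻_p(f ⊗ χ, χ(p)α, ω^i, T) = padicLFunctionMinusBranch` of an EVEN quadratic twist, and the plus branch that of an ODD quadratic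
twist (minus symbols of `f ⊗ χ` on plus symbols of `f`). No named fact is introduced (D-0026).

Motivation: crux stmt-BirchSwinnertonDyer-20368 road (C) (memo `Cruxes/SplitBadTwoRankOneOfFacts/PERIOD-CANCELS-w8g24.md` §6–§7,
gap T⁻⁻ (iii)): the odd classes `d* ∈ {−1, −2}` read `padicLFunctionMinusBranch f_V α_V 1`; its Birch transport to the base
curve makes the minus-period class constant cancel.

References: B. Mazur, J. Tate, J. Teitelbaum, Invent. Math. 84 (1986), §I.10 (10.1), §I.13 [MazurTateTeitelbaum1986Invent];
K. Matsuno, J. Number Theory 84 (2000), §2 (p. 83) [Matsuno2000].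
-/

noncomputable section

open scoped MatrixGroups ModularForm

open CongruenceSubgroup Filter Topology Literature.NumberTheory.EllipticCurves.ModularForms

namespace Literature.NumberTheory.EllipticCurves

section Branch

variable {N : ℕ} (f : CuspForm (Gamma0 N) 2) {p : ℕ} [Fact p.Prime] (m : ℕ) [NeZero m]

/-- The `n`-th **Riemann sum** for the `k`-th coefficient of the `ω^i`-branch of the PLUS tame transform:
`∑_ζ ζ^i ∑_{s mod pⁿ} ∑_{b mod m} χ(b) · μ_{f,α,m}((ζ γˢ + p^{n+e₀}ℤ_p) × {b}) · (s choose k)` (`ζ` over the torsion of `ℤ_pˣ`).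
[cite: MazurTateTeitelbaum1986Invent, §I.13 (pp. 18–19)] -/
def padicLRiemannSumTameBranch (α : ℚ_[p]) (χ : DirichletCharacter ℚ_[p] m) (i k n : ℕ) : ℚ_[p] :=
  ∑ᶠ ζ : rootsOfUnity (torsionOrder p) ℤ_[p], ∑ s : ZMod (p ^ n), ∑ b : ZMod m,
    (((ζ : ℤ_[p]ˣ) : ℤ_[p]) : ℚ_[p]) ^ i * (χ b *
      msdMeasureTame f m α (n + cyclotomicExponent p)
          (PadicInt.toZModPow (n + cyclotomicExponent p) ((ζ : ℤ_[p]ˣ) : ℤ_[p]) *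
            (cyclotomicGenerator p : ZMod (p ^ (n + cyclotomicExponent p))) ^ s.val) b *
      (s.val.choose k : ℚ_[p]))

/-- The `k`-th **coefficient** of the `ω^i`-branch of the plus tame transform (`limUnder`, junk off the convergent case).
[cite: MazurTateTeitelbaum1986Invent, §I.11–I.13 (pp. 13–19)] -/
def padicLCoeffTameBranch (α : ℚ_[p]) (χ : DirichletCharacter ℚ_[p] m) (i k : ℕ) : ℚ_[p] :=
  limUnder atTop (padicLRiemannSumTameBranch f m α χ i k)

/-- The **`ω^i`-branch of the `χ`-twisted PLUS tame transform**: `L_p(f, α, ω^i χ, T) = ∫ ω^i(x_p) χ(x_m) (1+T)^{ℓ(x_p)} dμ_{f,α,m}`.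
[cite: MazurTateTeitelbaum1986Invent, §I.13 (pp. 18–19)] -/
def padicLFunctionTameBranch (α : ℚ_[p]) (χ : DirichletCharacter ℚ_[p] m) (i : ℕ) : PowerSeries ℚ_[p] :=
  PowerSeries.mk (padicLCoeffTameBranch f m α χ i)

/-- The `k`-th coefficient of `L_p(f, α, ω^i χ, T)` (unfolding). [cite: MazurTateTeitelbaum1986Invent, §I.13 (pp. 18–19)] -/
theorem coeff_padicLFunctionTameBranch (α : ℚ_[p]) (χ : DirichletCharacter ℚ_[p] m) (i k : ℕ) :
    PowerSeries.coeff k (padicLFunctionTameBranch f m α χ i) = padicLCoeffTameBranch f m α χ i k :=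
  PowerSeries.coeff_mk _ _

/-- The `n`-th **Riemann sum** for the `k`-th coefficient of the `ω^i`-branch of the MINUS tame transform:
`∑_ζ ζ^i ∑_{s mod pⁿ} ∑_{b mod m} χ(b) · μ⁻_{f,α,m}((ζ γˢ + p^{n+e₀}ℤ_p) × {b}) · (s choose k)`.
[cite: MazurTateTeitelbaum1986Invent, §I.13 (pp. 18–19)] -/
def padicLRiemannSumTameMinusBranch (α : ℚ_[p]) (χ : DirichletCharacter ℚ_[p] m) (i k n : ℕ) : ℚ_[p] :=
  ∑ᶠ ζ : rootsOfUnity (torsionOrder p) ℤ_[p], ∑ s : ZMod (p ^ n), ∑ b : ZMod m,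
    (((ζ : ℤ_[p]ˣ) : ℤ_[p]) : ℚ_[p]) ^ i * (χ b *
      msdMeasureTameMinus f m α (n + cyclotomicExponent p)
          (PadicInt.toZModPow (n + cyclotomicExponent p) ((ζ : ℤ_[p]ˣ) : ℤ_[p]) *
            (cyclotomicGenerator p : ZMod (p ^ (n + cyclotomicExponent p))) ^ s.val) b *
      (s.val.choose k : ℚ_[p]))

/-- The `k`-th **coefficient** of the `ω^i`-branch of the minus tame transform (`limUnder`).
[cite: MazurTateTeitelbaum1986Invent, §I.11–I.13 (pp. 13–19)] -/
def padicLCoeffTameMinusBranch (α : ℚ_[p]) (χ : DirichletCharacter ℚ_[p] m) (i k : ℕ) : ℚ_[p] :=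
  limUnder atTop (padicLRiemannSumTameMinusBranch f m α χ i k)

/-- The **`ω^i`-branch of the `χ`-twisted MINUS tame transform**: `L⁻_p(f, α, ω^i χ, T) = ∫ ω^i(x_p) χ(x_m) (1+T)^{ℓ(x_p)} dμ⁻_{f,α,m}`.
[cite: MazurTateTeitelbaum1986Invent, §I.13 (pp. 18–19)] -/
def padicLFunctionTameMinusBranch (α : ℚ_[p]) (χ : DirichletCharacter ℚ_[p] m) (i : ℕ) : PowerSeries ℚ_[p] :=
  PowerSeries.mk (padicLCoeffTameMinusBranch f m α χ i)

/-- The `k`-th coefficient of `L⁻_p(f, α, ω^i χ, T)` (unfolding). [cite: MazurTateTeitelbaum1986Invent, §I.13 (pp. 18–19)] -/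
theorem coeff_padicLFunctionTameMinusBranch (α : ℚ_[p]) (χ : DirichletCharacter ℚ_[p] m) (i k : ℕ) :
    PowerSeries.coeff k (padicLFunctionTameMinusBranch f m α χ i) = padicLCoeffTameMinusBranch f m α χ i k :=
  PowerSeries.coeff_mk _ _

/-! #### Anchors at `i = 0`: the unweighted tame transforms -/

/-- **Anchor**: the `ω⁰`-branch Riemann sums of the plus tame transform ARE `padicLRiemannSumTame` (weight `ζ⁰ = 1`).
[cite: MazurTateTeitelbaum1986Invent, §I.13 (pp. 18–19)] -/
theorem padicLRiemannSumTameBranch_zero (α : ℚ_[p]) (χ : DirichletCharacter ℚ_[p] m) (k n : ℕ) :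
    padicLRiemannSumTameBranch f m α χ 0 k n = padicLRiemannSumTame f m α χ k n := by
  unfold padicLRiemannSumTameBranch padicLRiemannSumTame
  refine finsum_congr fun ζ => Finset.sum_congr rfl fun s _ => Finset.sum_congr rfl fun b _ => ?_
  rw [pow_zero, one_mul]

/-- **Anchor**: `padicLFunctionTameBranch f m α χ 0 = padicLFunctionTame f m α χ`. [cite: MazurTateTeitelbaum1986Invent, §I.13 (pp. 18–19)] -/
theorem padicLFunctionTameBranch_zero (α : ℚ_[p]) (χ : DirichletCharacter ℚ_[p] m) :
    padicLFunctionTameBranch f m α χ 0 = padicLFunctionTame f m α χ := by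
  ext k
  rw [coeff_padicLFunctionTameBranch, coeff_padicLFunctionTame]
  unfold padicLCoeffTameBranch padicLCoeffTame
  congr 1
  funext n
  exact padicLRiemannSumTameBranch_zero f m α χ k n

/-- **Anchor**: the `ω⁰`-branch Riemann sums of the minus tame transform ARE `padicLRiemannSumTameMinus`.
[cite: MazurTateTeitelbaum1986Invent, §I.13 (pp. 18–19)] -/
theorem padicLRiemannSumTameMinusBranch_zero (α : ℚ_[p]) (χ : DirichletCharacter ℚ_[p] m) (k n : ℕ) :
    padicLRiemannSumTameMinusBranch f m α χ 0 k n = padicLRiemannSumTameMinus f m α χ k n := by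
  unfold padicLRiemannSumTameMinusBranch padicLRiemannSumTameMinus
  refine finsum_congr fun ζ => Finset.sum_congr rfl fun s _ => Finset.sum_congr rfl fun b _ => ?_
  rw [pow_zero, one_mul]

/-- **Anchor**: `padicLFunctionTameMinusBranch f m α χ 0 = padicLFunctionTameMinus f m α χ`.
[cite: MazurTateTeitelbaum1986Invent, §I.13 (pp. 18–19)] -/
theorem padicLFunctionTameMinusBranch_zero (α : ℚ_[p]) (χ : DirichletCharacter ℚ_[p] m) :
    padicLFunctionTameMinusBranch f m α χ 0 = padicLFunctionTameMinus f m α χ := by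
  ext k
  rw [coeff_padicLFunctionTameMinusBranch, coeff_padicLFunctionTameMinus]
  unfold padicLCoeffTameMinusBranch padicLCoeffTameMinus
  congr 1
  funext n
  exact padicLRiemannSumTameMinusBranch_zero f m α χ k n

end Branch

end Literature.NumberTheory.EllipticCurves

end
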